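import Literature.Barriers.PneNP.RelativizationSparseTallyProofs
import Literature.Computability.Complexity.PlumbingBricks
import Literature.Computability.Complexity.PRelHierarchy
import Literature.Computability.Complexity.OracleEmpty
import HarnessLib

/-!
# Barrier catalogue `PneNP`: relativization over tally oracles — Long–Selman's tally theorem for
`NP` versus `coNP` (`NP = coNP ↔ ∀ tally T, NP^T = coNP^T`)

Sibling proof file of `Literature/Barriers/PneNP/RelativizationSparse.lean` and
`RelativizationSparseTallyProofs.lean` (which proves Long–Selman's tally theorem for `P` versus `NP`,
`longSelman1986_tally_holds : P = NP ↔ ∀ tally T, P^T = NP^T`). This file proves the companion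
statement of the same theorem of Long–Selman for `NP` versus `coNP`:

> T. J. Long, A. L. Selman, J. ACM 33 (1986); quoted as F. Egidy, arXiv:2602.02294 (2026), §3,
> Thm. 6 (second item, read with `lit read`): "`NP = coNP` if and only if `NP^T = coNP^T` for all
> `T ∈ TALLY`. [ls86]"

* `LongSelman.coNPRel_subset_NPRel_of_isTally` — if `NP = coNP` then `coNP^T ⊆ NP^T` for tally `T`;
* `NPRel_eq_coNPRel_of_isTally` — hence `NP^T = coNP^T`;
* `NP_eq_coNP_iff_cRelativizes_tally` — the `iff` (`←` at the tally oracle `∅`, through the tree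
  theorems `NPRel_empty : NP^∅ = NP`, `PRel_empty_holds`);
* the barrier reading: `NP ≠ coNP ↔ ∃ tally T, NP^T ≠ coNP^T`
  (`NP_ne_coNP_iff_exists_tally`, `tally_not_cRelativizes_NP_eq_coNP_iff`) — a tally oracle
  separating `NP` from `coNP` would be a PROOF of `NP ≠ coNP`; the collapse direction of the
  relativization barrier for `NP` versus `coNP` (the Baker–Gill–Solovay oracle `A` with
  `P^A = NP^A = coNP^A`) is carried by non-tally oracles only.

## The proof (transcript model of `Oracle.lean`; the devices of `RelativizationSparseTallyProofs`)

Let `NP = coNP`, `T` tally, `L ∈ coNP^T`, i.e. `Lᶜ ∈ NP^T`: `x ∈ Lᶜ ↔ ∃ y, |y| ≤ p|x| ∧ ⟨x, y⟩ ∈ L'`,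
`L' ∈ P^T` decided by `M` within `q` rounds with queries of length `≤ q`. Exactly as in the `P = NP`
file, with the table `t = table T m` of the tally oracle below `m = q(2|x| + 2 + p|x|) + 1` the
predicate `L₁ = {⟨x, t⟩ | ∃ y, |y| ≤ p|x| ∧ M^{table t} accepts ⟨x, y⟩}` is an unrelativized `NP`
predicate (`LongSelman.simL`, `mem_simL_iff`) and `⟨x, table T m⟩ ∈ L₁ ↔ x ∈ Lᶜ`. By `NP = coNP` its
COMPLEMENT is in `NP`: `z ∉ L₁ ↔ ∃ u, |u| ≤ r|z| ∧ ⟨z, u⟩ ∈ L₃`, `L₃ ∈ P`. The `NP^T` algorithm for `L`: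
guess `u`; on `⟨x, u⟩` read the table of `T` (a truth-table round of `AdaptiveQueries.adLang`, which
reads `m(|⟨x, u⟩|) ≥ m(|x|)` bits — the surplus is cut back to the canonical `m(|x|)` bits by the
`FP` bricks `Plumb.polyFn`, `Plumb.takeFn`), and accept iff `|u| ≤ r|⟨x, table⟩|` and
`⟨⟨x, table⟩, u⟩ ∈ L₃` — a `P^T` predicate of `⟨x, u⟩`; so `L ∈ ∃ᵖ·P^T = NP^T`.

What is NOT here: the converse positive relativization `NP ≠ coNP → ∀ tally T, NP^T ≠ coNP^T`
(not known); the sparse-oracle forms of Long–Selman / Balcázar–Book–Schöning for the polynomial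
hierarchy.

## References

* T. J. Long, A. L. Selman, *Relativizing complexity classes with sparse oracles*, J. ACM 33 (1986)
  618–627 [LongSelman1986] — not held (acq-00401); statement quoted from Egidy.
* F. Egidy, *The SPARSE-relativization framework and applications to optimal proof systems*,
  arXiv:2602.02294 (2026) [Egidy2026], §3 Thm. 6 (second item).
* U. Schöning, *Complexity and Structure*, LNCS 211 (1986) [Schoning1986], §6.1 (the table-reading
  argument, Thm. 6.3 / Cor. 6.4).
-/

namespace Literature.Barriers.PneNP

open _root_.Computability Literature.Computability.Complexity Literature.Computability.Complexity.Nondeterministic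
  Literature.Computability.Complexity.Classes Polynomial Brick

namespace LongSelman

/-- A shorter table is a prefix of a longer one: `(table T m') ↾ m = table T m` for `m ≤ m'`.
[folklore] -/
theorem take_table (T : Language Bool) {m m' : ℕ} (h : m ≤ m') : (table T m').take m = table T m := by
  simp only [table, ← List.map_take, List.take_range, Nat.min_eq_left h]

/-- **Long–Selman for `NP` versus `coNP`, main direction**: if `NP = coNP` then `coNP^T ⊆ NP^T` for
every tally `T` — guess the certificate of the complementary `NP` predicate of (input, table), read
the table of `T`, and verify. [cite: LongSelman1986, main theorem (tally form)] [cite: Egidy2026, §3 Thm. 6 (second item)] -/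
theorem coNPRel_subset_NPRel_of_isTally (hNC : Nondeterministic.NP = coNP) {T : Language Bool}
    (hT : IsTally T) : coNPRel (Oracle.ofLanguage T) ⊆ NPRel (Oracle.ofLanguage T) := by
  intro L hL
  change Lᶜ ∈ polyExists (PRel (Oracle.ofLanguage T)) at hL
  obtain ⟨L', hL', p, hp⟩ := hL
  obtain ⟨M, hM, q, hMq⟩ := hL'
  -- the table-fed verifier with the explicit witness-length test, and its `NP` projection
  set L₂ : Language Bool := simL M q ⊓ (forgetTableFn ⁻¹' LenLe p) with hL₂def
  have hL₂ : L₂ ∈ Classes.P :=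
    inter_mem_P (simL_mem_P hM q) (preimage_mem_P (LenLe_mem_P p) forgetTableFn_mem_FP)
  set L₁ : Language Bool := {z | ∃ y : List Bool, y.length ≤ p.eval z.length ∧ boolPair z y ∈ L₂}
    with hL₁def
  have hL₁NP : L₁ ∈ Nondeterministic.NP := ⟨L₂, hL₂, p, fun z => Iff.rfl⟩
  -- `NP = coNP`: the complement of `L₁` is an `NP` predicate
  have hL₁co : L₁ ∈ coNP := hNC ▸ hL₁NP
  change L₁ᶜ ∈ polyExists Classes.P at hL₁co
  obtain ⟨L₃, hL₃, r, hr⟩ := hL₁co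
  -- membership in `L₂` of a coded triple
  have hmemL₂ : ∀ x t y : List Bool, boolPair (boolPair x t) y ∈ L₂ ↔
      boolPair (boolPair x t) y ∈ simL M q ∧ y.length ≤ p.eval x.length := by
    intro x t y
    change (boolPair (boolPair x t) y ∈ simL M q ∧ forgetTableFn (boolPair (boolPair x t) y) ∈ LenLe p) ↔ _
    rw [forgetTableFn_apply, boolPair_mem_LenLe]
  -- the table length `m(|x|) = q(2|x| + 2 + p|x|) + 1` exceeds every query of `M` on `⟨x, y⟩`
  set mP : Polynomial ℕ := q.comp (2 * X + 2 + p) + 1 with hmPdef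
  have hmP : ∀ x y : List Bool, y.length ≤ p.eval x.length →
      q.eval (boolPair x y).length < mP.eval x.length := by
    intro x y hy
    have h1 : q.eval (boolPair x y).length ≤ q.eval (2 * x.length + 2 + p.eval x.length) :=
      TM2Iter.eval_mono q (by simp only [length_boolPair]; omega)
    have h2 : mP.eval x.length = q.eval (2 * x.length + 2 + p.eval x.length) + 1 := by
      simp only [hmPdef, eval_add, eval_comp, eval_mul, eval_ofNat, eval_X, eval_one]
    omega
  -- on `⟨x, y⟩` with `|y| ≤ p|x|`, the table-fed verifier accepts iff `⟨x, y⟩ ∈ L'`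
  have hsim : ∀ x y : List Bool, y.length ≤ p.eval x.length →
      (boolPair (boolPair x (table T (mP.eval x.length))) y ∈ simL M q ↔ boolPair x y ∈ L') := by
    intro x y hy
    obtain ⟨hrunT, hqT⟩ := hMq (boolPair x y)
    have hagree : ∀ u ∈ M.queries (Oracle.ofLanguage T) (q.eval (boolPair x y).length) (boolPair x y),
        Oracle.ofLanguage (tabLang (table T (mP.eval x.length))) u = Oracle.ofLanguage T u :=
      fun u hu => ofLanguage_tabLang_table hT ((hqT u hu).trans_lt (hmP x y hy))
    have hrun := (Literature.Computability.QuantumComplexity.run_congr M hagree).trans hrunT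
    have hqs : ∀ u ∈ M.queries (Oracle.ofLanguage (tabLang (table T (mP.eval x.length))))
        (q.eval (boolPair x y).length) (boolPair x y), u.length ≤ q.eval (boolPair x y).length := by
      rw [Literature.Computability.QuantumComplexity.queries_congr M hagree]
      exact hqT
    rw [mem_simL_iff hrun hqs]
    exact (Set.mem_iff_boolIndicator _ _).symm
  -- the canonical instance `⟨x, table⟩` of `L₁` decides `Lᶜ`
  have hz : ∀ x : List Bool, boolPair x (table T (mP.eval x.length)) ∈ L₁ ↔ x ∈ Lᶜ := by
    intro x
    rw [hp x]
    change (∃ y : List Bool, y.length ≤ p.eval (boolPair x (table T (mP.eval x.length))).length ∧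
      boolPair (boolPair x (table T (mP.eval x.length))) y ∈ L₂) ↔ _
    constructor
    · rintro ⟨y, -, hy⟩
      obtain ⟨hsy, hy⟩ := (hmemL₂ _ _ _).1 hy
      exact ⟨y, hy, (hsim x y hy).1 hsy⟩
    · rintro ⟨y, hy, hxy⟩
      refine ⟨y, hy.trans (TM2Iter.eval_mono p (by simp only [length_boolPair]; omega)), ?_⟩
      exact (hmemL₂ _ _ _).2 ⟨(hsim x y hy).2 hxy, hy⟩
  -- the truncation brick `⟨⟨x, u⟩, t'⟩ ↦ ⟨⟨x, t' ↾ m(|x|)⟩, u⟩` and the `P` test behind the oracle rounds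
  set trunc : List Bool → List Bool :=
    fanoutFn (fanoutFn (fstF ∘ fstF) (Plumb.takeFn ∘ fanoutFn (Plumb.polyFn mP ∘ fstF ∘ fstF) sndF))
      (sndF ∘ fstF) with htruncdef
  have htruncFP : trunc ∈ FP :=
    fanoutFn_mem_FP
      (fanoutFn_mem_FP (comp_mem_FP fstF_mem_FP fstF_mem_FP)
        (comp_mem_FP Plumb.takeFn_mem_FP
          (fanoutFn_mem_FP (comp_mem_FP (Plumb.polyFn_mem_FP mP) (comp_mem_FP fstF_mem_FP fstF_mem_FP))
            sndF_mem_FP)))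
      (comp_mem_FP sndF_mem_FP fstF_mem_FP)
  have htrunc : ∀ x u t' : List Bool,
      trunc (boolPair (boolPair x u) t') = boolPair (boolPair x (t'.take (mP.eval x.length))) u := by
    intro x u t'
    simp [htruncdef, List.length_replicate]
  set L₅ : Language Bool := trunc ⁻¹' (L₃ ⊓ LenLe r) with hL₅def
  have hL₅ : L₅ ∈ Classes.P := preimage_mem_P (inter_mem_P hL₃ (LenLe_mem_P r)) htruncFP
  -- the `P^T` verifier: read the table (`m(|⟨x, u⟩|) ≥ m(|x|)` bits), cut back, test
  set L₄ : Language Bool := AdQuery.adLang (Kannan.zerosFn ∘ sndP) mP L₅ T with hL₄def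
  have hL₄ : L₄ ∈ PRel (Oracle.ofLanguage T) :=
    AdQuery.adLang_mem_PRel (comp_mem_FP Kannan.zerosFn_mem_FP sndP_mem_FP) hL₅ T
  have hmemL₄ : ∀ x u : List Bool, boolPair x u ∈ L₄ ↔
      boolPair (boolPair x (table T (mP.eval x.length))) u ∈ L₃ ∧
        u.length ≤ r.eval (boolPair x (table T (mP.eval x.length))).length := by
    intro x u
    rw [hL₄def, AdQuery.mem_adLang_iff, adBits_eq_table]
    change trunc (boolPair (boolPair x u) (table T (mP.eval (boolPair x u).length))) ∈ L₃ ⊓ LenLe r ↔ _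
    rw [htrunc, take_table T (TM2Iter.eval_mono mP (by simp only [length_boolPair]; omega))]
    change (_ ∈ L₃ ∧ _ ∈ LenLe r) ↔ _
    rw [boolPair_mem_LenLe]
  -- the witness bound `r(|⟨x, table⟩|) ≤ r(2|x| + 2 + m|x|)`
  set p' : Polynomial ℕ := r.comp (2 * X + 2 + mP) with hp'def
  have hp' : ∀ x : List Bool,
      r.eval (boolPair x (table T (mP.eval x.length))).length = p'.eval x.length := by
    intro x
    simp only [hp'def, eval_comp, eval_add, eval_mul, eval_ofNat, eval_X, length_boolPair, length_table]
  refine ⟨L₄, hL₄, p', fun x => ⟨fun hx => ?_, ?_⟩⟩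
  · -- `x ∈ L`: the canonical instance is NOT in `L₁`, so its complement certificate exists
    have hx1 : boolPair x (table T (mP.eval x.length)) ∈ L₁ᶜ := fun h => ((hz x).1 h) hx
    obtain ⟨u, hu, hzu⟩ := (hr _).1 hx1
    exact ⟨u, (hp' x) ▸ hu, (hmemL₄ x u).2 ⟨hzu, hu⟩⟩
  · rintro ⟨u, -, hu⟩
    obtain ⟨hzu, hur⟩ := (hmemL₄ x u).1 hu
    have hx1 : boolPair x (table T (mP.eval x.length)) ∈ L₁ᶜ := (hr _).2 ⟨u, hur, hzu⟩
    by_contra hx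
    exact hx1 ((hz x).2 hx)

end LongSelman

/-! ### The theorem and its barrier reading -/

/-- **Long–Selman (1986), `NP` versus `coNP`, collapse direction**: if `NP = coNP` then
`NP^T = coNP^T` for every tally `T` (`coNP^T ⊆ NP^T` by `LongSelman.coNPRel_subset_NPRel_of_isTally`,
and then `NP^T = co coNP^T ⊆ co NP^T = coNP^T`). [cite: LongSelman1986, main theorem (tally form)] [cite: Egidy2026, §3 Thm. 6 (second item)] -/
theorem NPRel_eq_coNPRel_of_isTally (hNC : Nondeterministic.NP = coNP) {T : Language Bool}
    (hT : IsTally T) : NPRel (Oracle.ofLanguage T) = coNPRel (Oracle.ofLanguage T) := by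
  have h : coNPRel (Oracle.ofLanguage T) ⊆ NPRel (Oracle.ofLanguage T) :=
    LongSelman.coNPRel_subset_NPRel_of_isTally hNC hT
  refine Set.Subset.antisymm ?_ h
  have h' := co_mono h
  rwa [coNPRel, co_co] at h'

/-- **Long–Selman's tally theorem for `NP` versus `coNP`**: `NP = coNP ↔ ∀ tally T, NP^T = coNP^T`
(`→` above; `←` at the tally oracle `∅ = Oracle.ofLanguage 0`, where `NP^∅ = NP` by the tree theorem
`NPRel_empty` and `coNP^∅ = co NP^∅`). [cite: LongSelman1986, main theorem (tally form)] [cite: Egidy2026, §3 Thm. 6 (second item)] -/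
theorem NP_eq_coNP_iff_cRelativizes_tally :
    Nondeterministic.NP = coNP ↔ CRelativizes {T | IsTally T} fun O => NPRel O = coNPRel O := by
  refine ⟨fun hNC T hT => NPRel_eq_coNPRel_of_isTally hNC hT, fun h => ?_⟩
  have h0 : NPRel Oracle.empty = coNPRel Oracle.empty := h 0 isTally_zero
  rwa [coNPRel, NPRel_empty] at h0

/-- Barrier reading: `NP ≠ coNP ↔` some TALLY oracle separates `NP` from `coNP`. A tally no-go
against `NP = coNP` would itself prove `NP ≠ coNP`; the collapsing worlds of the relativization
barrier for `NP` versus `coNP` are necessarily non-tally. [cite: LongSelman1986, main theorem (tally form)] [cite: Egidy2026, §3 Thm. 6 (second item)] -/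
theorem NP_ne_coNP_iff_exists_tally :
    Nondeterministic.NP ≠ coNP ↔
      ∃ T : Language Bool, IsTally T ∧ NPRel (Oracle.ofLanguage T) ≠ coNPRel (Oracle.ofLanguage T) := by
  rw [Ne, NP_eq_coNP_iff_cRelativizes_tally, not_cRelativizes_iff]
  rfl

/-- The same as a statement about `CRelativizes`: `NP = coNP` fails to be TALLY-relativizing iff
`NP ≠ coNP`. [cite: LongSelman1986, main theorem (tally form)] [cite: Egidy2026, §3 Thm. 6 (second item)] -/
theorem tally_not_cRelativizes_NP_eq_coNP_iff :
    (¬ CRelativizes {T | IsTally T} fun O => NPRel O = coNPRel O) ↔ Nondeterministic.NP ≠ coNP :=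
  not_congr NP_eq_coNP_iff_cRelativizes_tally.symm

/-- One direction survives for the separation: if `O ↦ NP^O ≠ coNP^O` holds at every tally oracle
then `NP ≠ coNP` (the instance `T = ∅`). [cite: Egidy2026, §3 (tally-oracle-independent statements)] -/
theorem NP_ne_coNP_of_cRelativizes_tally
    (h : CRelativizes {T | IsTally T} fun O => NPRel O ≠ coNPRel O) : Nondeterministic.NP ≠ coNP := by
  have h0 : NPRel Oracle.empty ≠ coNPRel Oracle.empty := h 0 isTally_zero
  rwa [coNPRel, NPRel_empty] at h0

end Literature.Barriers.PneNP
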